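import Summits.Ventures.LatticeQCDFlow.Exactness.ReversibleVariationalFloorThinned
import Summits.Ventures.LatticeQCDFlow.Exactness.ReversibleStickySet
import HarnessLib

/-!
# A sticky set slows EVERY observable that overlaps it: `Σ_k ρ_g(k) rᵏ ≥ ⟨g, χ − a⟩²/(C_g(0)((1 − r)(1 − a) + rε) ∫χw)`, and the sticky indicator itself has `Σ_k ρ(k) rᵏ ≥ (1 − a)/((1 − r)(1 − a) + rε)` with NO summability hypothesis

HONEST FRAMING: exact (Metropolis-corrected) sampling algorithms for lattice gauge theory;
figures of merit are autocorrelation/cost numbers at stated couplings and volumes; no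
continuum-physics claim.  (SCALAR calibration rung S0-A: not a gauge result.)

Venture `LatticeQCDFlow` (cell pub-lqcd), topic `Exactness`; FANOUT row 2 (`s0-phi4`).  NEW WORK
of the cell, composing the variational floor (`Exactness/ReversibleVariationalFloor.lean`, Abel form,
unconditional; `ReversibleVariationalFloorThinned.lean`, dominated `τ_int` form) with the sticky-set
Dirichlet bound of `Exactness/ReversibleStickySet.lean` (`𝓔(χ − c) ≤ ε ∫ χ w` when the `0/1`
indicator `χ` is left with probability `≤ ε`).  Nothing is cited as a fact.  Printed counterpart
NAMED ONLY: the Roberts–Tweedie 1996 rejection criterion (a set left with probability `≤ ε` forces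
`‖K‖ ≥ 1 − ε` on `L²₀`); here quantitative, for every observable overlapping the set, and in the
Abel-regularised form that does not presuppose a summable autocorrelation series.

## What is proved (namespace `RevOp`; reversible exact sampler in the admissible-class format with
`1 ∈ A`; `χ ∈ A` with values in `{0,1}`, mass `∫ χ w = a ∫ w > 0`, `a < 1`; `g ∈ A`, `P = C_g(0)`,
`ρ(k) = C_g(k)/P`, `B = ∫ g (χ − a) w`; `0 ≤ r < 1`)

* **`abelSum_autocorr_ge_of_indicator_dirichlet_le`** — if `𝓔(χ − a) ≤ ε ∫ χ w` (`ε ≥ 0`) then for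
  every `g ∈ A` with `P > 0`:  **`Σ_{k≥0} ρ(k) rᵏ ≥ B² / (P · ((1 − r)(1 − a) + r ε) ∫ χ w)`**;
* **`abelSum_autocorr_ge_indicator_self`** — `g = χ − a`:
  **`Σ_{k≥0} ρ(k) rᵏ ≥ (1 − a) / ((1 − r)(1 − a) + r ε)`** — as `r ↑ 1` the right side tends to
  `(1 − a)/ε`: the Abel-regularised `τ_int + ½` of the indicator is at least `(1 − a)/ε` with NO
  summability and NO `ρ(1) < 1` hypothesis (gen-16's `autocorr_ge_of_sticky` gave `ρ(1) ≥ 1 − 2ε`);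
* `abelSum_autocorr_ge_of_sticky`, `abelSum_autocorr_ge_sticky_self` — the same from the kernel-level
  stickiness `K[1 − χ] ≤ ε` on `{χ = 1}` (`K 1 = 1`);
* **`tauInt_ge_of_indicator_dirichlet_le`** — under summability of the autocorrelation series of `g`:
  **`τ_int(g) ≥ B² / (P ε ∫ χ w) − ½`** — every observable with `Cov(g, χ) ≠ 0` inherits the
  stickiness (`B = Cov_w(g, χ)` for centred `g`).

The lattice instance (row 2's HMC arm and its far boxes: the no-spectral-gap theorem in Abel form,
free of the summability caveat, and its cross-observable version) is
`Exactness/Phi4HMCNoSpectralGapAbel.lean`.  NOT CLAIMED: summability for any sampler; that any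
particular observable of interest overlaps a sticky set appreciably (for the HMC tail boxes the
overlap of `M` is tiny — the statement is structural).
-/

namespace Summit.Ventures.LatticeQCDFlow.Exactness

open Real MeasureTheory Filter Finset
open Summit.Ventures.LatticeQCDFlow.Scoring

namespace RevOp

variable {X : Type*} [MeasurableSpace X] {μ : Measure X} {w : X → ℝ} {A : (X → ℝ) → Prop}
  {K : (X → ℝ) → (X → ℝ)}

/-- **A SET WITH SMALL DIRICHLET FORM SLOWS EVERY OBSERVABLE THAT OVERLAPS IT (Abel form).**
`χ ∈ A` `0/1`-valued with `a ∫ w = ∫ χ w > 0`, `a < 1`, `𝓔(χ − a) ≤ ε ∫ χ w`; then for every `g ∈ A`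
with `C_g(0) > 0` and every `0 ≤ r < 1`:
`Σ_{k≥0} ρ_g(k) rᵏ ≥ (∫ g (χ − a) w)² / (C_g(0) · ((1 − r)(1 − a) + r ε) ∫ χ w)`. -/
theorem abelSum_autocorr_ge_of_indicator_dirichlet_le (hw0 : ∀ x, 0 ≤ w x) (hA1 : A (fun _ => (1 : ℝ)))
    (hAi : ∀ ⦃f h : X → ℝ⦄, A f → A h → Integrable (fun x => f x * h x * w x) μ)
    (hAc : ∀ ⦃f h : X → ℝ⦄ (c : ℝ), A f → A h → A (fun x => f x + c * h x))
    (hAK : ∀ ⦃f : X → ℝ⦄, A f → A (K f))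
    (hlin : ∀ ⦃f h : X → ℝ⦄ (c : ℝ), A f → A h →
      ∀ x, K (fun s => f s + c * h s) x = K f x + c * K h x)
    (hsymm : ∀ ⦃f h : X → ℝ⦄, A f → A h →
      ∫ x, K f x * h x * w x ∂μ = ∫ x, f x * K h x * w x ∂μ)
    (hcontr : ∀ ⦃f : X → ℝ⦄, A f → ∫ x, K f x ^ 2 * w x ∂μ ≤ ∫ x, f x ^ 2 * w x ∂μ)
    {χ : X → ℝ} (hχ : A χ) (h01 : ∀ x, χ x = 0 ∨ χ x = 1) {a : ℝ}
    (ha : a * ∫ x, w x ∂μ = ∫ x, χ x * w x ∂μ) (hpos : 0 < ∫ x, χ x * w x ∂μ) (ha1 : a < 1)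
    {ε : ℝ} (hε : 0 ≤ ε)
    (hdir : (∫ x, (χ x - a) ^ 2 * w x ∂μ) - ∫ x, (χ x - a) * K (fun y => χ y - a) x * w x ∂μ
      ≤ ε * ∫ x, χ x * w x ∂μ)
    {g : X → ℝ} (hg : A g) (hP : 0 < ∫ x, g x ^ 2 * w x ∂μ) {r : ℝ} (hr0 : 0 ≤ r) (hr1 : r < 1) :
    (∫ x, g x * (χ x - a) * w x ∂μ) ^ 2
        / ((∫ x, g x ^ 2 * w x ∂μ) * (((1 - r) * (1 - a) + r * ε) * ∫ x, χ x * w x ∂μ))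
      ≤ ∑' k, (∫ x, g x * (K^[k] g) x * w x ∂μ) / (∫ x, g x ^ 2 * w x ∂μ) * r ^ k := by
  have hv : A (fun x => χ x - a) := sub_const_mem hA1 hAc hχ a
  have hmain := sq_inner_le_abelSum_mul_quadForm hw0 hAi hAc hAK hlin hsymm hcontr hg hv hr0 hr1
  have hvar := indicator_var_eq hA1 hAi hχ h01 ha
  have hA0 := abelSum_nonneg hw0 hAi hAK hsymm hcontr hg hr0 hr1
  set P := ∫ x, g x ^ 2 * w x ∂μ with hPdef
  set I := ∫ x, χ x * w x ∂μ with hI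
  set S := ∑' k, (∫ x, g x * (K^[k] g) x * w x ∂μ) * r ^ k with hS
  set Qt := ((1 - r) * (1 - a) + r * ε) * I with hQt
  -- the regularised Dirichlet form of `χ − a` is at most `Qt`
  have hQle : (∫ x, (χ x - a) ^ 2 * w x ∂μ) - r * ∫ x, (χ x - a) * K (fun y => χ y - a) x * w x ∂μ
      ≤ Qt := by
    have e : (∫ x, (χ x - a) ^ 2 * w x ∂μ) - r * ∫ x, (χ x - a) * K (fun y => χ y - a) x * w x ∂μ
        = (1 - r) * (∫ x, (χ x - a) ^ 2 * w x ∂μ)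
          + r * ((∫ x, (χ x - a) ^ 2 * w x ∂μ)
            - ∫ x, (χ x - a) * K (fun y => χ y - a) x * w x ∂μ) := by ring
    rw [e, hvar, hQt]
    nlinarith [mul_le_mul_of_nonneg_left hdir hr0]
  have hQt0 : 0 < Qt := by
    have h1 : 0 < (1 - r) * (1 - a) := mul_pos (by linarith) (by linarith)
    exact mul_pos (by nlinarith [mul_nonneg hr0 hε]) hpos
  have hB : (∫ x, g x * (χ x - a) * w x ∂μ) ^ 2 ≤ S * Qt :=
    hmain.trans (mul_le_mul_of_nonneg_left hQle hA0)
  have e : ∑' k, (∫ x, g x * (K^[k] g) x * w x ∂μ) / P * r ^ k = S / P := by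
    rw [hS, ← tsum_div_const]
    exact tsum_congr fun k => by ring
  rw [e, div_le_div_iff₀ (mul_pos hP hQt0) hP]
  nlinarith [hB, hP]

/-- **THE INDICATOR ITSELF (Abel form, unconditional)**: under the same hypotheses, with
`ρ(k) = C_{χ−a}(k)/C_{χ−a}(0)`:  `Σ_{k≥0} ρ(k) rᵏ ≥ (1 − a) / ((1 − r)(1 − a) + r ε)` for every
`0 ≤ r < 1` — as `r ↑ 1` the bound tends to `(1 − a)/ε`. -/
theorem abelSum_autocorr_ge_indicator_self (hw0 : ∀ x, 0 ≤ w x) (hA1 : A (fun _ => (1 : ℝ)))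
    (hAi : ∀ ⦃f h : X → ℝ⦄, A f → A h → Integrable (fun x => f x * h x * w x) μ)
    (hAc : ∀ ⦃f h : X → ℝ⦄ (c : ℝ), A f → A h → A (fun x => f x + c * h x))
    (hAK : ∀ ⦃f : X → ℝ⦄, A f → A (K f))
    (hlin : ∀ ⦃f h : X → ℝ⦄ (c : ℝ), A f → A h →
      ∀ x, K (fun s => f s + c * h s) x = K f x + c * K h x)
    (hsymm : ∀ ⦃f h : X → ℝ⦄, A f → A h →
      ∫ x, K f x * h x * w x ∂μ = ∫ x, f x * K h x * w x ∂μ)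
    (hcontr : ∀ ⦃f : X → ℝ⦄, A f → ∫ x, K f x ^ 2 * w x ∂μ ≤ ∫ x, f x ^ 2 * w x ∂μ)
    {χ : X → ℝ} (hχ : A χ) (h01 : ∀ x, χ x = 0 ∨ χ x = 1) {a : ℝ}
    (ha : a * ∫ x, w x ∂μ = ∫ x, χ x * w x ∂μ) (hpos : 0 < ∫ x, χ x * w x ∂μ) (ha1 : a < 1)
    {ε : ℝ} (hε : 0 ≤ ε)
    (hdir : (∫ x, (χ x - a) ^ 2 * w x ∂μ) - ∫ x, (χ x - a) * K (fun y => χ y - a) x * w x ∂μ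
      ≤ ε * ∫ x, χ x * w x ∂μ)
    {r : ℝ} (hr0 : 0 ≤ r) (hr1 : r < 1) :
    (1 - a) / ((1 - r) * (1 - a) + r * ε)
      ≤ ∑' k, (∫ x, (χ x - a) * (K^[k] (fun y => χ y - a)) x * w x ∂μ)
          / (∫ x, (χ x - a) ^ 2 * w x ∂μ) * r ^ k := by
  have hv : A (fun x => χ x - a) := sub_const_mem hA1 hAc hχ a
  have hvar := indicator_var_eq hA1 hAi hχ h01 ha
  have hP : 0 < ∫ x, (χ x - a) ^ 2 * w x ∂μ := by rw [hvar]; exact mul_pos (by linarith) hpos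
  have h := abelSum_autocorr_ge_of_indicator_dirichlet_le hw0 hA1 hAi hAc hAK hlin hsymm hcontr
    hχ h01 ha hpos ha1 hε hdir hv hP hr0 hr1
  have hB : ∫ x, (χ x - a) * (χ x - a) * w x ∂μ = ∫ x, (χ x - a) ^ 2 * w x ∂μ :=
    integral_congr_ae (Eventually.of_forall fun x => by ring)
  rw [hB, hvar] at h
  have hden : 0 < (1 - r) * (1 - a) + r * ε := by
    have h1 : 0 < (1 - r) * (1 - a) := mul_pos (by linarith) (by linarith)
    nlinarith [mul_nonneg hr0 hε]
  have e : ((1 - a) * ∫ x, χ x * w x ∂μ) ^ 2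
        / ((1 - a) * (∫ x, χ x * w x ∂μ) * (((1 - r) * (1 - a) + r * ε) * ∫ x, χ x * w x ∂μ))
      = (1 - a) / ((1 - r) * (1 - a) + r * ε) := by
    field_simp
  rw [e] at h
  simpa only [hvar] using h

/-- **Kernel-level stickiness** (`K 1 = 1`, `K[1 − χ] ≤ ε` on `{χ = 1}`): for every `g ∈ A` with
`C_g(0) > 0`,  `Σ_{k≥0} ρ_g(k) rᵏ ≥ (∫ g (χ − a) w)² / (C_g(0) · ((1 − r)(1 − a) + r ε) ∫ χ w)`. -/
theorem abelSum_autocorr_ge_of_sticky (hw0 : ∀ x, 0 ≤ w x) (hA1 : A (fun _ => (1 : ℝ)))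
    (hAi : ∀ ⦃f h : X → ℝ⦄, A f → A h → Integrable (fun x => f x * h x * w x) μ)
    (hAc : ∀ ⦃f h : X → ℝ⦄ (c : ℝ), A f → A h → A (fun x => f x + c * h x))
    (hAK : ∀ ⦃f : X → ℝ⦄, A f → A (K f))
    (hlin : ∀ ⦃f h : X → ℝ⦄ (c : ℝ), A f → A h →
      ∀ x, K (fun s => f s + c * h s) x = K f x + c * K h x)
    (hsymm : ∀ ⦃f h : X → ℝ⦄, A f → A h →
      ∫ x, K f x * h x * w x ∂μ = ∫ x, f x * K h x * w x ∂μ)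
    (hcontr : ∀ ⦃f : X → ℝ⦄, A f → ∫ x, K f x ^ 2 * w x ∂μ ≤ ∫ x, f x ^ 2 * w x ∂μ)
    (hunit : ∀ x, K (fun _ => (1 : ℝ)) x = 1)
    {χ : X → ℝ} (hχ : A χ) (h01 : ∀ x, χ x = 0 ∨ χ x = 1) {a : ℝ}
    (ha : a * ∫ x, w x ∂μ = ∫ x, χ x * w x ∂μ) (hpos : 0 < ∫ x, χ x * w x ∂μ) (ha1 : a < 1)
    {ε : ℝ} (hε : 0 ≤ ε) (hsticky : ∀ x, χ x = 1 → K (fun y => 1 - χ y) x ≤ ε)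
    {g : X → ℝ} (hg : A g) (hP : 0 < ∫ x, g x ^ 2 * w x ∂μ) {r : ℝ} (hr0 : 0 ≤ r) (hr1 : r < 1) :
    (∫ x, g x * (χ x - a) * w x ∂μ) ^ 2
        / ((∫ x, g x ^ 2 * w x ∂μ) * (((1 - r) * (1 - a) + r * ε) * ∫ x, χ x * w x ∂μ))
      ≤ ∑' k, (∫ x, g x * (K^[k] g) x * w x ∂μ) / (∫ x, g x ^ 2 * w x ∂μ) * r ^ k :=
  abelSum_autocorr_ge_of_indicator_dirichlet_le hw0 hA1 hAi hAc hAK hlin hsymm hcontr hχ h01 ha hpos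
    ha1 hε (dirichlet_indicator_le_of_sticky hw0 hA1 hAi hAc hAK hlin hsymm hunit hχ h01 hsticky a)
    hg hP hr0 hr1

/-- **The sticky indicator itself, kernel-level form**:
`Σ_{k≥0} ρ_{χ−a}(k) rᵏ ≥ (1 − a) / ((1 − r)(1 − a) + r ε)`, no summability hypothesis. -/
theorem abelSum_autocorr_ge_sticky_self (hw0 : ∀ x, 0 ≤ w x) (hA1 : A (fun _ => (1 : ℝ)))
    (hAi : ∀ ⦃f h : X → ℝ⦄, A f → A h → Integrable (fun x => f x * h x * w x) μ)
    (hAc : ∀ ⦃f h : X → ℝ⦄ (c : ℝ), A f → A h → A (fun x => f x + c * h x))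
    (hAK : ∀ ⦃f : X → ℝ⦄, A f → A (K f))
    (hlin : ∀ ⦃f h : X → ℝ⦄ (c : ℝ), A f → A h →
      ∀ x, K (fun s => f s + c * h s) x = K f x + c * K h x)
    (hsymm : ∀ ⦃f h : X → ℝ⦄, A f → A h →
      ∫ x, K f x * h x * w x ∂μ = ∫ x, f x * K h x * w x ∂μ)
    (hcontr : ∀ ⦃f : X → ℝ⦄, A f → ∫ x, K f x ^ 2 * w x ∂μ ≤ ∫ x, f x ^ 2 * w x ∂μ)
    (hunit : ∀ x, K (fun _ => (1 : ℝ)) x = 1)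
    {χ : X → ℝ} (hχ : A χ) (h01 : ∀ x, χ x = 0 ∨ χ x = 1) {a : ℝ}
    (ha : a * ∫ x, w x ∂μ = ∫ x, χ x * w x ∂μ) (hpos : 0 < ∫ x, χ x * w x ∂μ) (ha1 : a < 1)
    {ε : ℝ} (hε : 0 ≤ ε) (hsticky : ∀ x, χ x = 1 → K (fun y => 1 - χ y) x ≤ ε)
    {r : ℝ} (hr0 : 0 ≤ r) (hr1 : r < 1) :
    (1 - a) / ((1 - r) * (1 - a) + r * ε)
      ≤ ∑' k, (∫ x, (χ x - a) * (K^[k] (fun y => χ y - a)) x * w x ∂μ)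
          / (∫ x, (χ x - a) ^ 2 * w x ∂μ) * r ^ k :=
  abelSum_autocorr_ge_indicator_self hw0 hA1 hAi hAc hAK hlin hsymm hcontr hχ h01 ha hpos ha1 hε
    (dirichlet_indicator_le_of_sticky hw0 hA1 hAi hAc hAK hlin hsymm hunit hχ h01 hsticky a) hr0 hr1

/-- **EVERY OBSERVABLE OVERLAPPING A STICKY SET INHERITS ITS STICKINESS (`τ_int` form).**  If
`𝓔(χ − a) ≤ ε ∫ χ w` and the autocorrelation series of `g ∈ A` is summable, then
`τ_int(g) ≥ (∫ g (χ − a) w)² / (C_g(0) · ε ∫ χ w) − ½`. -/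
theorem tauInt_ge_of_indicator_dirichlet_le (hw0 : ∀ x, 0 ≤ w x) (hA1 : A (fun _ => (1 : ℝ)))
    (hAi : ∀ ⦃f h : X → ℝ⦄, A f → A h → Integrable (fun x => f x * h x * w x) μ)
    (hAc : ∀ ⦃f h : X → ℝ⦄ (c : ℝ), A f → A h → A (fun x => f x + c * h x))
    (hAK : ∀ ⦃f : X → ℝ⦄, A f → A (K f))
    (hlin : ∀ ⦃f h : X → ℝ⦄ (c : ℝ), A f → A h →
      ∀ x, K (fun s => f s + c * h s) x = K f x + c * K h x)
    (hsymm : ∀ ⦃f h : X → ℝ⦄, A f → A h →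
      ∫ x, K f x * h x * w x ∂μ = ∫ x, f x * K h x * w x ∂μ)
    (hcontr : ∀ ⦃f : X → ℝ⦄, A f → ∫ x, K f x ^ 2 * w x ∂μ ≤ ∫ x, f x ^ 2 * w x ∂μ)
    {χ : X → ℝ} (hχ : A χ) (a : ℝ) {ε : ℝ}
    (hdir : (∫ x, (χ x - a) ^ 2 * w x ∂μ) - ∫ x, (χ x - a) * K (fun y => χ y - a) x * w x ∂μ
      ≤ ε * ∫ x, χ x * w x ∂μ)
    {g : X → ℝ} (hg : A g)
    (hs : Summable fun k => (∫ x, g x * (K^[k + 1] g) x * w x ∂μ) / ∫ x, g x ^ 2 * w x ∂μ) :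
    (∫ x, g x * (χ x - a) * w x ∂μ) ^ 2 / ((∫ x, g x ^ 2 * w x ∂μ) * (ε * ∫ x, χ x * w x ∂μ))
        - 1 / 2
      ≤ tauInt (fun k => (∫ x, g x * (K^[k] g) x * w x ∂μ) / ∫ x, g x ^ 2 * w x ∂μ) :=
  tauInt_ge_variational_of_le hw0 hAi hAc hAK hlin hsymm hcontr hg (sub_const_mem hA1 hAc hχ a)
    hs hdir

end RevOp

end Summit.Ventures.LatticeQCDFlow.Exactness
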